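import Summits.CriticalPhenomena.PercolationContinuityZ3.Theorems.PercNearOneGluingNoHeavyQuantFarSunSupportLemma
import HarnessLib

/-!
# FAR beyond trees: two corollaries of the support lemma — the empty and the full ghost outcome bet only on the CORE `[j, K−j−1]` and never use `b`

builds on p205010 (kernel theorem, internal audit signed; external expert review pending)

Support file (`--supports stmt-CriticalPhenomena-4575`), seat `prim-cert-1` (gen 30); memo `prim-cert-1/FROM-prim-cert-1-g30-SUPPORT-LEMMA.md` §1.
`TK.support_lemma` (`…QuantFarSunSupportLemma`) says that a ghost outcome leaving some window `[s, s+K−j)` (`s ≤ j`) unsplit bets only inside that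
window and has `b = 0`.  The outcomes `∅` and `range K` leave EVERY window unsplit, and the intersection of all windows is the core `[j, K−j−1]`
(on the top layer `K = 2j+1`: the middle relay alone).  Hence, in every reached-set-level certificate for `SunFAR K j` (`2j+1 ≤ K`):
* `TK.b_empty_eq_zero`, `TK.b_full_eq_zero` — `b(∅) = b(range K) = 0`;
* `TK.a_empty_eq_zero_off_core`, `TK.a_full_eq_zero_off_core` — `a_k(∅) = a_k(range K) = 0` for `k < j` and for `K − j ≤ k < K`
  (these are the boundary zeros of gen 23's closed-form layer-one certificate `T_K`, and "the empty ghost bets on the middle" on the top layer).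
Elementary [this work]; no sorries, standard axioms.
-/

namespace Summit.CriticalPhenomena.PercolationContinuityZ3.Theorems.HairyCycle

namespace TK

open Finset

variable {K j : ℕ} {a : ℕ → Finset ℕ → ℤ} {b : Finset ℕ → ℤ}

/-- `b(∅) = 0` in every certificate (`2j+1 ≤ K`). [this work] -/
theorem b_empty_eq_zero (hK : 2 * j + 1 ≤ K)
    (ha : ∀ k, ∀ R', R' ⊆ range K → 0 ≤ a k R') (hb : ∀ R', R' ⊆ range K → 0 ≤ b R')
    (hcore : ∀ l m u v : ℕ, m ≤ l → l ≤ K + 1 → u ≤ v → v ≤ K →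
      ∀ Z T : Finset ℕ, Z ⊆ range K → T ⊆ range K → Disjoint Z T →
        0 ≤ (∑ J ∈ T.powerset, Wgen K j a b (cov K l u ∩ (Z ∪ J)) (cov K m v ∩ (Z ∪ (T \ J)))) +
          ∑ J ∈ T.powerset, Wgen K j a b (cov K l v ∩ (Z ∪ J)) (cov K m u ∩ (Z ∪ (T \ J)))) :
    b ∅ = 0 :=
  support_lemma_b hK ha hb hcore (Nat.zero_le j) (empty_subset _) (Or.inr (disjoint_empty_right _))

/-- `b(range K) = 0` in every certificate (`2j+1 ≤ K`). [this work] -/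
theorem b_full_eq_zero (hK : 2 * j + 1 ≤ K)
    (ha : ∀ k, ∀ R', R' ⊆ range K → 0 ≤ a k R') (hb : ∀ R', R' ⊆ range K → 0 ≤ b R')
    (hcore : ∀ l m u v : ℕ, m ≤ l → l ≤ K + 1 → u ≤ v → v ≤ K →
      ∀ Z T : Finset ℕ, Z ⊆ range K → T ⊆ range K → Disjoint Z T →
        0 ≤ (∑ J ∈ T.powerset, Wgen K j a b (cov K l u ∩ (Z ∪ J)) (cov K m v ∩ (Z ∪ (T \ J)))) +
          ∑ J ∈ T.powerset, Wgen K j a b (cov K l v ∩ (Z ∪ J)) (cov K m u ∩ (Z ∪ (T \ J)))) :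
    b (range K) = 0 :=
  support_lemma_b hK ha hb hcore (Nat.zero_le j) subset_rfl
    (Or.inl fun k hk => by rw [mem_Ico] at hk; rw [mem_range]; omega)

/-- A position off the core `[j, K−j−1]` misses some window: for `k < j` or `K − j ≤ k < K` there is `s ≤ j` with `k ∉ [s, s+K−j)`. [this work] -/
theorem exists_window_avoiding (hK : 2 * j + 1 ≤ K) {k : ℕ} (hk : k < K) (hoff : k < j ∨ K - j ≤ k) :
    ∃ s, s ≤ j ∧ k ∉ Ico s (s + (K - j)) := by
  rcases hoff with h | h
  · exact ⟨k + 1, by omega, fun hm => by rw [mem_Ico] at hm; omega⟩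
  · exact ⟨k - (K - j), by omega, fun hm => by rw [mem_Ico] at hm; omega⟩

/-- **The empty ghost bets only on the core**: `a_k(∅) = 0` for `k < j` and for `K − j ≤ k < K` (`2j+1 ≤ K`). [this work] -/
theorem a_empty_eq_zero_off_core (hK : 2 * j + 1 ≤ K)
    (ha : ∀ k, ∀ R', R' ⊆ range K → 0 ≤ a k R') (hb : ∀ R', R' ⊆ range K → 0 ≤ b R')
    (hcore : ∀ l m u v : ℕ, m ≤ l → l ≤ K + 1 → u ≤ v → v ≤ K →
      ∀ Z T : Finset ℕ, Z ⊆ range K → T ⊆ range K → Disjoint Z T →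
        0 ≤ (∑ J ∈ T.powerset, Wgen K j a b (cov K l u ∩ (Z ∪ J)) (cov K m v ∩ (Z ∪ (T \ J)))) +
          ∑ J ∈ T.powerset, Wgen K j a b (cov K l v ∩ (Z ∪ J)) (cov K m u ∩ (Z ∪ (T \ J))))
    {k : ℕ} (hk : k < K) (hoff : k < j ∨ K - j ≤ k) : a k ∅ = 0 := by
  obtain ⟨s, hs, hks⟩ := exists_window_avoiding hK hk hoff
  exact support_lemma_a hK ha hb hcore hs (empty_subset _) (Or.inr (disjoint_empty_right _)) hk hks

/-- **The full ghost bets only on the core**: `a_k(range K) = 0` for `k < j` and for `K − j ≤ k < K` (`2j+1 ≤ K`). [this work] -/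
theorem a_full_eq_zero_off_core (hK : 2 * j + 1 ≤ K)
    (ha : ∀ k, ∀ R', R' ⊆ range K → 0 ≤ a k R') (hb : ∀ R', R' ⊆ range K → 0 ≤ b R')
    (hcore : ∀ l m u v : ℕ, m ≤ l → l ≤ K + 1 → u ≤ v → v ≤ K →
      ∀ Z T : Finset ℕ, Z ⊆ range K → T ⊆ range K → Disjoint Z T →
        0 ≤ (∑ J ∈ T.powerset, Wgen K j a b (cov K l u ∩ (Z ∪ J)) (cov K m v ∩ (Z ∪ (T \ J)))) +
          ∑ J ∈ T.powerset, Wgen K j a b (cov K l v ∩ (Z ∪ J)) (cov K m u ∩ (Z ∪ (T \ J))))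
    {k : ℕ} (hk : k < K) (hoff : k < j ∨ K - j ≤ k) : a k (range K) = 0 := by
  obtain ⟨s, hs, hks⟩ := exists_window_avoiding hK hk hoff
  exact support_lemma_a hK ha hb hcore hs subset_rfl
    (Or.inl fun i hi => by rw [mem_Ico] at hi; rw [mem_range]; omega) hk hks

end TK

end Summit.CriticalPhenomena.PercolationContinuityZ3.Theorems.HairyCycle
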